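import Literature.AlgebraicGeometry.HodgeTheory.MotivatedClassesPointAuxiliary
import Literature.AlgebraicGeometry.HodgeTheory.LefschetzOneOne
import HarnessLib

/-!
# André's Thm. 0.6.2 in the Lefschetz range of codimensions: Hodge classes of codimension `p ≤ 1` or `p ≥ dim − 1` are motivated (proof file; no named fact)

Family `hodge`, layer `Literature/AlgebraicGeometry/HodgeTheory`. Companion (theorems only, no new
named fact, D-0026) of `MotivatedClasses.lean` for its named fact
`Andre1996_hodgeClasses_abelianVariety_motivated` (Y. André, *Pour une théorie inconditionnelle des
motifs*, Publ. Math. IHÉS 83 (1996), Théorème 0.6.2, p. 9: "Tout cycle de Hodge `ξ` sur une variété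
abélienne `A` est motivé"; on the real carriers: every rational class of Hodge type `(p, p)` in
`H²ᵖ(A(ℂ); ℂ)` lies in `A_motᵖ(A)_ℂ = motivatedClasses A.dim A.X p`).

What is proved here is the part of that statement which does NOT need André's argument (§6.3:
deformation Thm. 0.5, Mumford families of Hodge type, reduction to Weil cycles [A92b] and to
powers of an elliptic curve): the codimensions in which rational `(p, p)`-classes are ALGEBRAIC on
every smooth projective complex `n`-fold by the two classical Lefschetz theorems — `p = 0`
(`N⁰ H⁰ = H⁰`, `algebraicClasses_zero`), `p = 1` (Lefschetz's theorem on `(1,1)`-classes, Voisin I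
Thm. 11.30, the tree's named fact `lefschetzOneOne_rational`), `n < 2p` with `n − p ≤ 1` (hard
Lefschetz from codimension `n − p`, Voisin I Thm. 6.25 with Rem. 6.27 and §7.1.2, the tree's named
fact `nonempty_hardLefschetzNFold n X` through its PROVED consequence
`mem_algebraicClasses_of_lt_of_nonempty`; Murre 1977, Remark 1: "It is well-known that the `(1,1)`
and `(3,3)`-conjecture are true for any fourfold"), and `p > n` (no non-zero `(p,p)`-classes,
`IsOfHodgeType.eq_zero_pp_of_lt`, proved) — combined with André's remark "il est clair que
`A_mot(X)_E` contient `A(X)`" (§2.1, p. 14), PROVED on the real carriers in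
`MotivatedClassesPointAuxiliary` (`algebraicClasses_le_motivatedClasses_of_nonempty_hardLefschetzNFold_self`,
under the hard Lefschetz datum of `X` itself, which supplies the polarisation class of `X ⊗ Spec ℂ`
that André's generators require).

* `mem_algebraicClasses_of_lefschetzRange` — for `X` smooth projective of dimension `n`, granted
  `lefschetzOneOne_rational` and `nonempty_hardLefschetzNFold n X`: a rational `(p,p)`-class with
  `p ≤ 1` or `n ≤ p + 1` is algebraic (`∈ Nᵖ H²ᵖ(X(ℂ); ℂ)`).
* `mem_motivatedClasses_of_lefschetzRange` — hence motivated; `mem_motivatedClasses_of_dim_lt` —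
  the degrees `p > n` unconditionally (`c = 0`).
* `Andre1996_hodgeClasses_abelianVariety_motivated.of_lefschetzRange` — **Thm. 0.6.2 in the
  codimensions `p ≤ 1` and `p ≥ dim A − 1`** for a complex abelian variety `A`, granted the two named
  facts; `Andre1996_hodgeClasses_abelianVariety_motivated.of_dim_le_three` — hence **Thm. 0.6.2 for
  abelian varieties of dimension `≤ 3`** (every codimension is in the range), and
  `….of_hodgeClasses_algebraic_of_dim_le_three` — the same from the tree's named fact
  `hodgeClasses_algebraic_of_dim_le_three` (Voisin II, proof of Prop. 10.26) instead of Lefschetz `(1,1)`.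
* `Andre1996_hodgeClasses_abelianVariety_motivated_of_middle_range` — the assembly: granted the two
  named facts for all abelian varieties, the fact `Andre1996_hodgeClasses_abelianVariety_motivated`
  follows from its restriction to the codimensions `2 ≤ p ≤ dim A − 2` (so `dim A ≥ 4`) — the range
  where Thm. 0.6.2 has content beyond the Lefschetz theorems (e.g. the Weil classes of abelian
  fourfolds of Weil type, §6.3 b)), and where nothing is claimed here.

Nothing in this file is specific to abelian varieties except the final specialisations to the shape
of the named fact; no step of André's own proof of Thm. 0.6.2 is formalised here (those that are —
`A(X) ⊆ A_mot(X)`, `*_L A(X) ⊆ A_mot(X)`, the graph formalism, `pr_{X*} A_mot(X ⊗ Z) ⊆ A_mot(X)`, the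
§6.3 glue under Thm. 0.5 — live in `MotivatedClassesAlgebraic`, `MotivatedClassesPointAuxiliary`,
`MotivatedClassesPushforward`).

## References

* [Andre1996Motifs] Y. André, Pour une théorie inconditionnelle des motifs, Publ. Math. IHÉS 83
  (1996) 5–49: Thm. 0.6.2 (p. 9), §2.1 remark following Déf. 1 (p. 14), §6.3 (pp. 31–33).
* [VoisinHodgeI2002] C. Voisin, Hodge Theory and Complex Algebraic Geometry I, CUP 2002, Thm. 6.25,
  Rem. 6.27, §7.1.2, Thm. 11.30.
* [VoisinHodgeII2003] C. Voisin, Hodge Theory and Complex Algebraic Geometry II, CUP 2003, §10.2.3,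
  proof of Prop. 10.26.
* [Murre1977] J. P. Murre, On the Hodge conjecture for unirational fourfolds, Indag. Math. 80 (1977)
  230–232, Remark 1.
-/

noncomputable section

namespace Literature.AlgebraicGeometry.HodgeTheory

section HodgeTheory

open Literature.AlgebraicTopology.SingularHomology

variable {n : ℕ} {X : Motives.SchemeOver ℂ}

/-! ### Smooth projective `n`-folds: the Lefschetz range of codimensions -/

/-- **Rational `(p,p)`-classes of codimension `p ≤ 1` or `p ≥ n − 1` are algebraic** on a smooth
projective complex `n`-fold, granted Lefschetz `(1,1)` (`hL`) and the hard Lefschetz datum of `X`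
(`hHL`): `p = 0` is `N⁰ H⁰ = H⁰`, `p = 1` is Lefschetz `(1,1)`, and for `n < 2p` with `n − p ≤ 1` the
class comes by `L^{2p−n}` from a rational `(n−p, n−p)`-class, algebraic by the two previous cases
(`mem_algebraicClasses_of_lt_of_nonempty`; this covers `p > n` as well).
[cite: VoisinHodgeI2002, Thm. 6.25, Rem. 6.27, §7.1.2 and Thm. 11.30] [cite: Murre1977, Remark 1] -/
theorem mem_algebraicClasses_of_lefschetzRange (hL : lefschetzOneOne_rational)
    (hHL : nonempty_hardLefschetzNFold n X) (hX : Motives.IsSmoothProjective n X) {p : ℕ}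
    (hp : p ≤ 1 ∨ n ≤ p + 1) (c : complexBetti X (2 * p)) (hc : IsRationalClass c)
    (hpp : IsOfHodgeType n X (2 * p) p p c) : c ∈ algebraicClasses X p := by
  -- the codimensions `q ≤ 1` directly
  have low : ∀ q : ℕ, q ≤ 1 → ∀ c' : complexBetti X (2 * q), IsRationalClass c' →
      IsOfHodgeType n X (2 * q) q q c' → c' ∈ algebraicClasses X q := by
    intro q hq c' hc' hqq
    interval_cases q
    · rw [algebraicClasses_zero]
      exact Submodule.mem_top
    · exact hL hX c' hc' hqq
  by_cases h2 : n < 2 * p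
  · -- hard Lefschetz from codimension `n - p ≤ 1`
    exact mem_algebraicClasses_of_lt_of_nonempty hHL hX h2 (low (n - p) (by omega)) c hc hpp
  · -- `2p ≤ n`, so `n ≤ p + 1` forces `p ≤ 1`
    exact low p (by omega) c hc hpp

/-- **Rational `(p,p)`-classes of codimension `p ≤ 1` or `p ≥ n − 1` are motivated** on a smooth
projective complex `n`-fold, granted Lefschetz `(1,1)` and the hard Lefschetz datum of `X`: they are
algebraic (`mem_algebraicClasses_of_lefschetzRange`), and `A(X) ⊆ A_mot(X)` ("il est clair que
`A_mot(X)_E` contient `A(X)`", proved under the hard Lefschetz datum of `X` in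
`algebraicClasses_le_motivatedClasses_of_nonempty_hardLefschetzNFold_self`).
[cite: Andre1996Motifs, §2.1 remark following Déf. 1 (p. 14)]
[cite: VoisinHodgeI2002, Thm. 6.25 and Thm. 11.30] -/
theorem mem_motivatedClasses_of_lefschetzRange (hL : lefschetzOneOne_rational)
    (hHL : nonempty_hardLefschetzNFold n X) (hX : Motives.IsSmoothProjective n X) {p : ℕ}
    (hp : p ≤ 1 ∨ n ≤ p + 1) (c : complexBetti X (2 * p)) (hc : IsRationalClass c)
    (hpp : IsOfHodgeType n X (2 * p) p p c) : c ∈ motivatedClasses n X p :=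
  algebraicClasses_le_motivatedClasses_of_nonempty_hardLefschetzNFold_self hX hHL p
    (mem_algebraicClasses_of_lefschetzRange hL hHL hX hp c hc hpp)

/-- Above the dimension there is nothing to prove: for `p > n` a class of Hodge type `(p,p)` in
`H²ᵖ(X(ℂ); ℂ)` is `0` (`IsOfHodgeType.eq_zero_pp_of_lt`: no non-zero `2p`-forms on the real
`2n`-manifold `X^an`), hence motivated — unconditionally. [cite: VoisinHodgeI2002, §7.1.1] -/
theorem mem_motivatedClasses_of_dim_lt {p : ℕ} (hp : n < p) (c : complexBetti X (2 * p))
    (hpp : IsOfHodgeType n X (2 * p) p p c) : c ∈ motivatedClasses n X p := by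
  rw [hpp.eq_zero_pp_of_lt hp]
  exact Submodule.zero_mem _

/-! ### Abelian varieties: the shape of the named fact -/

/-- **André's Thm. 0.6.2 in the codimensions `p ≤ 1` and `p ≥ dim A − 1`**: for a complex abelian
variety `A` (smooth projective of dimension `A.dim`, witness `hA`), granted Lefschetz `(1,1)` (`hL`)
and the hard Lefschetz datum of `A` (`hHL`), every rational class of Hodge type `(p,p)` in
`H²ᵖ(A(ℂ); ℂ)` with `p ≤ 1` or `A.dim ≤ p + 1` lies in `A_motᵖ(A)_ℂ` — the Lefschetz range, where the
class is algebraic; the content of Thm. 0.6.2 is the complementary range `2 ≤ p ≤ dim A − 2`.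
[cite: Andre1996Motifs, Thm. 0.6.2 (p. 9) and §2.1 remark following Déf. 1 (p. 14)]
[cite: VoisinHodgeI2002, Thm. 6.25 and Thm. 11.30] -/
theorem Andre1996_hodgeClasses_abelianVariety_motivated.of_lefschetzRange
    (hL : lefschetzOneOne_rational) (A : Motives.AbelianVariety ℂ)
    (hHL : nonempty_hardLefschetzNFold A.dim A.X) (hA : Motives.IsSmoothProjective A.dim A.X)
    {p : ℕ} (hp : p ≤ 1 ∨ A.dim ≤ p + 1) (c : complexBetti A.X (2 * p)) (hc : IsRationalClass c)
    (hpp : IsOfHodgeType A.dim A.X (2 * p) p p c) : c ∈ motivatedClasses A.dim A.X p :=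
  mem_motivatedClasses_of_lefschetzRange hL hHL hA hp c hc hpp

/-- **André's Thm. 0.6.2 for abelian varieties of dimension `≤ 3`** (elliptic curves, abelian
surfaces and threefolds), granted Lefschetz `(1,1)` and the hard Lefschetz datum of `A`: every
codimension `p` satisfies `p ≤ 1` or `dim A ≤ p + 1`, so every rational `(p,p)`-class is algebraic,
hence motivated. [cite: Andre1996Motifs, Thm. 0.6.2 (p. 9) and §2.1 remark following Déf. 1 (p. 14)]
[cite: VoisinHodgeII2003, §10.2.3 proof of Prop. 10.26] -/
theorem Andre1996_hodgeClasses_abelianVariety_motivated.of_dim_le_three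
    (hL : lefschetzOneOne_rational) (A : Motives.AbelianVariety ℂ) (h3 : A.dim ≤ 3)
    (hHL : nonempty_hardLefschetzNFold A.dim A.X) (hA : Motives.IsSmoothProjective A.dim A.X)
    (p : ℕ) (c : complexBetti A.X (2 * p)) (hc : IsRationalClass c)
    (hpp : IsOfHodgeType A.dim A.X (2 * p) p p c) : c ∈ motivatedClasses A.dim A.X p :=
  mem_motivatedClasses_of_lefschetzRange hL hHL hA (by omega) c hc hpp

/-- The same from the tree's named fact `hodgeClasses_algebraic_of_dim_le_three` (the Hodge
conjecture in dimension `≤ 3`, Voisin II proof of Prop. 10.26) in place of Lefschetz `(1,1)`: on an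
abelian variety of dimension `≤ 3` every rational `(p,p)`-class is algebraic (`h3`), hence motivated
(`A(X) ⊆ A_mot(X)` under the hard Lefschetz datum `hHL` of `A`).
[cite: Andre1996Motifs, Thm. 0.6.2 (p. 9) and §2.1 remark following Déf. 1 (p. 14)]
[cite: VoisinHodgeII2003, §10.2.3 proof of Prop. 10.26] -/
theorem Andre1996_hodgeClasses_abelianVariety_motivated.of_hodgeClasses_algebraic_of_dim_le_three
    (h3 : hodgeClasses_algebraic_of_dim_le_three) (A : Motives.AbelianVariety ℂ) (hdim : A.dim ≤ 3)
    (hHL : nonempty_hardLefschetzNFold A.dim A.X) (hA : Motives.IsSmoothProjective A.dim A.X)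
    (p : ℕ) (c : complexBetti A.X (2 * p)) (hc : IsRationalClass c)
    (hpp : IsOfHodgeType A.dim A.X (2 * p) p p c) : c ∈ motivatedClasses A.dim A.X p :=
  algebraicClasses_le_motivatedClasses_of_nonempty_hardLefschetzNFold_self hA hHL p
    (h3 hdim hA p c hc hpp)

/-- **Assembly: Thm. 0.6.2 reduces to the codimensions `2 ≤ p ≤ dim A − 2`.** Granted Lefschetz
`(1,1)` and the hard Lefschetz datum of every complex abelian variety, the named fact
`Andre1996_hodgeClasses_abelianVariety_motivated` follows from its restriction `hmid` to the classes
of codimension `2 ≤ p ≤ dim A − 2` (abelian varieties of dimension `≥ 4`; e.g. the Weil classes of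
§6.3 b)) — the range in which André's proof (§6.3: Thm. 0.5 and Lemmes 6.3.1–6.3.3) is the only
known road, none of which is asserted here. [cite: Andre1996Motifs, Thm. 0.6.2 (p. 9) and §6.3 (pp. 31–33)]
[cite: VoisinHodgeI2002, Thm. 6.25 and Thm. 11.30] -/
theorem Andre1996_hodgeClasses_abelianVariety_motivated_of_middle_range
    (hL : lefschetzOneOne_rational)
    (hHL : ∀ A : Motives.AbelianVariety ℂ, nonempty_hardLefschetzNFold A.dim A.X)
    (hmid : ∀ (A : Motives.AbelianVariety ℂ) (_ : Motives.IsSmoothProjective A.dim A.X) (p : ℕ),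
      2 ≤ p → p + 2 ≤ A.dim → ∀ c : complexBetti A.X (2 * p), IsRationalClass c →
        IsOfHodgeType A.dim A.X (2 * p) p p c → c ∈ motivatedClasses A.dim A.X p) :
    Andre1996_hodgeClasses_abelianVariety_motivated := by
  intro A hA p c hc hpp
  by_cases hp : p ≤ 1 ∨ A.dim ≤ p + 1
  · exact mem_motivatedClasses_of_lefschetzRange hL (hHL A) hA hp c hc hpp
  · exact hmid A hA p (by omega) (by omega) c hc hpp

end HodgeTheory

end Literature.AlgebraicGeometry.HodgeTheory

end
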